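import Mathlib.Analysis.SpecialFunctions.Pow.Real
import Mathlib.Analysis.SpecialFunctions.Pow.NNReal
import Mathlib.Analysis.SpecialFunctions.Sqrt
import Mathlib.Algebra.BigOperators.Group.Finset.Basic
import Mathlib.Tactic.Linarith
import Mathlib.Tactic.Positivity
import Mathlib.Tactic.FieldSimp
import HarnessLib

/-!
# Volkov 2020 (NPB 961, 115232): from Theorem 3.1's Hepp-sector bound to eq. (1.9) — a Speer-form product ∏_{l≥2} t_l^{d_l} with ALL exponents d_l ≥ ½ and all sector variables 0 < t_l ≤ 1 is at most (∏_{l≥2} t_l)^{1/2} = (z_min/z_max)^{1/2}, and on the Feynman simplex z_max ≥ 1/L, so the sector-wise bound becomes the sector-free «|I′(z)| ≤ C (min z)^{1/2}/(z₁⋯z_L)» with C ↦ C·√L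

independent recomputation; certified where stated, statistical where stated; no new-physics claim.

CITATION HEADER (venture `QEDPrecision`, cell `pub-qed`, track TROPICAL seat V3b = `pub-qed-trop-v3-lit-2` gen 6; VALUE-FREE: elementary real analysis
on the SHAPE of the printed bound only — no integrand, no graph, nothing per word). Companion of `Volkov2020.UVDegreeHandshake` (the ω side);
serves `tropical/view/V3-VOLKOV-DEGREES.md` §B B.1 (Theorem 3.1 ⇒ (1.9): "This leads to the absolute convergence"; "The power 1/2 in (1.9) is
unimprovable") and B.11.2 (f) (the exponent profile of the theorem: ≥ ½ on every level l ≥ 2).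

Source. [Volkov2020] S. Volkov, "Infrared and ultraviolet power counting on the mass shell in quantum electrodynamics", Nucl. Phys. B 961
(2020) 115232 = arXiv:1912.04885v4 (e-print tex `iclos_arxiv.tex`, held by the cell under `pub-qed-trop-v3-lit-2/sources/arxiv-1912.04885/`):
* §1 eq. (1.6) and §3.1 (journal p.3, p.10): the Hepp sector z_{j₁} ≥ z_{j₂} ≥ … ≥ z_{j_L} with sector variables "t₁ = z_{j₁}, t_l = z_{j_l}/z_{j_{l−1}}
  (l ≥ 2)", and "We will also use the fact that z₁,…,z_L are Feynman parameters, i.e., z₁ + … + z_L = 1. Therefore, t₁,…,t_L ≤ 1."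
* §3.3 Theorem 3.1 (journal p.17): "|I′(z₁,…,z_L)| ≤ C · ∏_{l=2}^{L} t_l^{max(⌈−ω(IClos(s^{[l]}))⌉ − ½, ½)} / (z₁…z_L), where C is some constant depending
  only on the structure of the graph. Let us remark that we ignore the multiplier containing t₁ (because we use the Feynman parameters,
  1/L ≤ t₁ ≤ 1)."
* §1 eq. (1.9) (journal p.5): "|I′(z)| ≤ C · (min(z₁,…,z_L))^{1/2} / (z₁·…·z_L). This leads to the absolute convergence of the Feynman parametric
  integral. The power 1/2 in (1.9) is unimprovable …".
The passage Theorem 3.1 ⇒ (1.9) is left to the reader in print; this file is that passage, as arithmetic: every exponent of the theorem is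
≥ ½ (it is a `max(·, ½)`), each t_l ≤ 1, so the product of powers is ≤ the product of square roots = the square root of the product, which
telescopes to z_{j_L}/z_{j₁} = (min z)/(max z); and max z ≥ (Σ z)/L = 1/L.

What the kernel certifies (Mathlib real powers `Real.rpow`; finite products over `Finset`):
* `thm31_exponent_ge_half` — max(a − ½, ½) ≥ ½ for every real a (the theorem's exponents), `thm31_exponent_pos`;
* `rpow_le_sqrt_of_le_one` — 0 < t ≤ 1 and ½ ≤ d ⇒ t^d ≤ t^{1/2};
* `prod_rpow_le_prod_sqrt` — for finitely many sector variables with 0 < t_i ≤ 1 and exponents d_i ≥ ½: ∏ t_i^{d_i} ≤ ∏ t_i^{1/2};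
  `prod_sqrt_eq_sqrt_prod` — ∏ t_i^{1/2} = (∏ t_i)^{1/2}; together `speer_half_bound` — ∏ t_i^{d_i} ≤ (∏ t_i)^{1/2};
* `prod_ratio_telescope` — for z : ℕ → ℝ nowhere zero, ∏_{i<n} z(i+1)/z(i) = z(n)/z(0): along a Hepp sector the product of the t_l, l ≥ 2, is
  z_{j_L}/z_{j₁} (smallest over largest);
* `exists_ge_inv_card_of_sum_eq_one` — if L ≥ 1 numbers sum to 1 then one of them (a fortiori the largest) is ≥ 1/L (the printed "1/L ≤ t₁ ≤ 1",
  left half), hence `ratio_le_card_mul`: z_min/z_max ≤ L·z_min, and `sqrt_ratio_le`: (z_min/z_max)^{1/2} ≤ L^{1/2}·(z_min)^{1/2};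
* `thm31_to_eq19` — the assembly: C·∏ t_l^{d_l}/P ≤ C·L^{1/2}·(z_min)^{1/2}/P for any C ≥ 0, P > 0 (P = z₁⋯z_L in print) once ∏ t_l = z_min/z_max —
  i.e. Theorem 3.1's right-hand side is bounded by (1.9)'s right-hand side with the constant C·√L.
NOT claimed: Theorem 3.1 itself (the bound on I′), the integrability of (min z)^{1/2}/∏z over the simplex (a Hepp-sector integral, cf. the tree's
`HeppSectorIntegral`), or the sharpness example of the Appendix.
-/

open Finset Real

namespace Literature.MathematicalPhysics.QuantumFieldTheory.Volkov2020

/-! ## The exponents of Theorem 3.1 are all ≥ ½ -/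

/-- Every exponent of Theorem 3.1, max(⌈−ω(IClos(s^{[l]}))⌉ − ½, ½), is ≥ ½ (stated for an arbitrary real in place of the integer ⌈−ω⌉).
[cite: Volkov2020, Theorem 3.1 (journal p.17)] -/
theorem thm31_exponent_ge_half (a : ℝ) : (1 / 2 : ℝ) ≤ max (a - 1 / 2) (1 / 2) := le_max_right _ _

/-- … hence every exponent of Theorem 3.1 is positive — the Hepp-sector form of "absolute convergence" needs exactly this on the levels l ≥ 2.
[cite: Volkov2020, Theorem 3.1 and eq. (1.9) (journal p.17, p.5)] -/
theorem thm31_exponent_pos (a : ℝ) : (0 : ℝ) < max (a - 1 / 2) (1 / 2) :=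
  lt_of_lt_of_le (by norm_num) (thm31_exponent_ge_half a)

/-! ## Powers of sector variables t ∈ (0, 1] -/

/-- For a sector variable 0 < t ≤ 1 and an exponent d ≥ ½: t^d ≤ t^{1/2}. [cite: Volkov2020, §3.1 ("t₁,…,t_L ≤ 1") and Theorem 3.1 (journal p.10, p.17)] -/
theorem rpow_le_sqrt_of_le_one {t d : ℝ} (ht0 : 0 < t) (ht1 : t ≤ 1) (hd : 1 / 2 ≤ d) : t ^ d ≤ t ^ (1 / 2 : ℝ) :=
  Real.rpow_le_rpow_of_exponent_ge ht0 ht1 hd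

/-- Product form: for finitely many sector variables 0 < t_i ≤ 1 with exponents d_i ≥ ½, ∏ t_i^{d_i} ≤ ∏ t_i^{1/2}.
[cite: Volkov2020, Theorem 3.1 ⇒ eq. (1.9) (journal p.17, p.5)] -/
theorem prod_rpow_le_prod_sqrt {ι : Type*} (s : Finset ι) (t d : ι → ℝ)
    (ht0 : ∀ i ∈ s, 0 < t i) (ht1 : ∀ i ∈ s, t i ≤ 1) (hd : ∀ i ∈ s, 1 / 2 ≤ d i) :
    ∏ i ∈ s, t i ^ d i ≤ ∏ i ∈ s, t i ^ (1 / 2 : ℝ) := by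
  apply Finset.prod_le_prod
  · intro i hi; exact le_of_lt (Real.rpow_pos_of_pos (ht0 i hi) _)
  · intro i hi; exact rpow_le_sqrt_of_le_one (ht0 i hi) (ht1 i hi) (hd i hi)

/-- ∏ t_i^{1/2} = (∏ t_i)^{1/2} for nonnegative t_i. [cite: Volkov2020, eq. (1.9) (journal p.5)] -/
theorem prod_sqrt_eq_sqrt_prod {ι : Type*} (s : Finset ι) (t : ι → ℝ) (ht : ∀ i ∈ s, 0 ≤ t i) :
    ∏ i ∈ s, t i ^ (1 / 2 : ℝ) = (∏ i ∈ s, t i) ^ (1 / 2 : ℝ) :=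
  Real.finsetProd_rpow s t ht (1 / 2)

/-- THE SPEER-FORM HALF BOUND: ∏ t_i^{d_i} ≤ (∏ t_i)^{1/2} whenever 0 < t_i ≤ 1 and d_i ≥ ½ for all i — the step from Theorem 3.1's sector-wise
product to a single power of the product of the sector variables. [cite: Volkov2020, Theorem 3.1 ⇒ eq. (1.9) (journal p.17, p.5)] -/
theorem speer_half_bound {ι : Type*} (s : Finset ι) (t d : ι → ℝ)
    (ht0 : ∀ i ∈ s, 0 < t i) (ht1 : ∀ i ∈ s, t i ≤ 1) (hd : ∀ i ∈ s, 1 / 2 ≤ d i) :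
    ∏ i ∈ s, t i ^ d i ≤ (∏ i ∈ s, t i) ^ (1 / 2 : ℝ) := by
  rw [← prod_sqrt_eq_sqrt_prod s t (fun i hi => le_of_lt (ht0 i hi))]
  exact prod_rpow_le_prod_sqrt s t d ht0 ht1 hd

/-! ## The product of the sector variables telescopes to z_min / z_max -/

/-- Telescoping: for a nowhere-zero sequence z, ∏_{i<n} z(i+1)/z(i) = z(n)/z(0). Along a Hepp sector (z(0) = z_{j₁} ≥ z(1) = z_{j₂} ≥ …) the
factors are the printed t_{l} = z_{j_l}/z_{j_{l−1}}, l ≥ 2, so their product is z_{j_L}/z_{j₁} = (min z)/(max z).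
[cite: Volkov2020, eq. (1.6) and §3.1 (journal p.3, p.10)] -/
theorem prod_ratio_telescope (z : ℕ → ℝ) (hz : ∀ i, z i ≠ 0) (n : ℕ) :
    ∏ i ∈ range n, z (i + 1) / z i = z n / z 0 := by
  induction n with
  | zero => simp [div_self (hz 0)]
  | succ n ih =>
    rw [Finset.prod_range_succ, ih]
    have h0 := hz 0; have hn := hz n
    field_simp

/-! ## On the Feynman simplex the largest parameter is ≥ 1/L -/

/-- If L ≥ 1 reals indexed by `Fin L` sum to 1, some coordinate is ≥ 1/L (the left half of the printed "1/L ≤ t₁ ≤ 1", t₁ = max z).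
[cite: Volkov2020, Theorem 3.1, closing remark (journal p.17)] -/
theorem exists_ge_inv_card_of_sum_eq_one {L : ℕ} (hL : 0 < L) (z : Fin L → ℝ) (hsum : ∑ i, z i = 1) :
    ∃ i, (1 : ℝ) / L ≤ z i := by
  by_contra h
  push Not at h
  have hlt : ∑ i, z i < ∑ _i : Fin L, (1 : ℝ) / L := by
    apply Finset.sum_lt_sum_of_nonempty
    · exact Finset.univ_nonempty_iff.mpr ⟨⟨0, hL⟩⟩
    · intro i _; exact h i
  rw [hsum, Finset.sum_const, Finset.card_univ, Fintype.card_fin] at hlt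
  have hL' : (L : ℝ) ≠ 0 := by exact_mod_cast (ne_of_gt hL)
  have : L • ((1 : ℝ) / L) = 1 := by rw [nsmul_eq_mul]; field_simp
  rw [this] at hlt
  exact lt_irrefl _ hlt

/-- Hence for a maximal coordinate zmax (z i ≤ zmax for all i, zmax one of them) and any coordinate zmin > 0: zmin/zmax ≤ L·zmin.
[cite: Volkov2020, Theorem 3.1 ⇒ eq. (1.9) (journal p.17, p.5)] -/
theorem ratio_le_card_mul {L : ℕ} (hL : 0 < L) (z : Fin L → ℝ) (hsum : ∑ i, z i = 1)
    (zmax zmin : ℝ) (hmax : ∀ i, z i ≤ zmax) (hmin : 0 ≤ zmin) :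
    zmin / zmax ≤ L * zmin := by
  obtain ⟨i, hi⟩ := exists_ge_inv_card_of_sum_eq_one hL z hsum
  have hLpos : (0 : ℝ) < L := by exact_mod_cast hL
  have hzmax : (1 : ℝ) / L ≤ zmax := le_trans hi (hmax i)
  have hzmax_pos : 0 < zmax := lt_of_lt_of_le (by positivity) hzmax
  rw [div_le_iff₀ hzmax_pos]
  have : zmin ≤ L * zmin * zmax := by
    have h1 : (1 : ℝ) ≤ L * zmax := by
      have := mul_le_mul_of_nonneg_left hzmax hLpos.le
      rw [mul_one_div_cancel (ne_of_gt hLpos)] at this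
      exact this
    nlinarith
  linarith

/-- … and with square roots: (zmin/zmax)^{1/2} ≤ √L · zmin^{1/2} — eq. (1.9)'s constant absorbs √L. [cite: Volkov2020, eq. (1.9) (journal p.5)] -/
theorem sqrt_ratio_le {L : ℕ} (hL : 0 < L) (z : Fin L → ℝ) (hsum : ∑ i, z i = 1)
    (zmax zmin : ℝ) (hmax : ∀ i, z i ≤ zmax) (hmin : 0 ≤ zmin) :
    (zmin / zmax) ^ (1 / 2 : ℝ) ≤ (L : ℝ) ^ (1 / 2 : ℝ) * zmin ^ (1 / 2 : ℝ) := by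
  have h := ratio_le_card_mul hL z hsum zmax zmin hmax hmin
  obtain ⟨i, hi⟩ := exists_ge_inv_card_of_sum_eq_one hL z hsum
  have hLpos : (0 : ℝ) < L := by exact_mod_cast hL
  have hzmax_pos : 0 < zmax := lt_of_lt_of_le (by positivity) (le_trans hi (hmax i))
  have hratio_nonneg : 0 ≤ zmin / zmax := div_nonneg hmin hzmax_pos.le
  rw [← Real.mul_rpow hLpos.le hmin]
  exact Real.rpow_le_rpow hratio_nonneg h (by norm_num)

/-! ## Assembly: Theorem 3.1's right-hand side ≤ (1.9)'s right-hand side with C ↦ C·√L -/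

/-- Theorem 3.1 ⇒ eq. (1.9), as printed shape: with sector variables 0 < t_l ≤ 1 (l ≥ 2) whose product is z_min/z_max, exponents d_l ≥ ½,
Feynman parameters z summing to 1 with maximum z_max and a nonnegative z_min, any constant C ≥ 0 and any positive denominator P (= z₁⋯z_L):
C · ∏ t_l^{d_l} / P ≤ C · L^{1/2} · z_min^{1/2} / P. [cite: Volkov2020, Theorem 3.1 (journal p.17) ⇒ eq. (1.9) (journal p.5)] -/
theorem thm31_to_eq19 {ι : Type*} (s : Finset ι) (t d : ι → ℝ)
    (ht0 : ∀ i ∈ s, 0 < t i) (ht1 : ∀ i ∈ s, t i ≤ 1) (hd : ∀ i ∈ s, 1 / 2 ≤ d i)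
    {L : ℕ} (hL : 0 < L) (z : Fin L → ℝ) (hsum : ∑ i, z i = 1)
    (zmax zmin : ℝ) (hmax : ∀ i, z i ≤ zmax) (hmin : 0 ≤ zmin)
    (htel : ∏ i ∈ s, t i = zmin / zmax)
    (C P : ℝ) (hC : 0 ≤ C) (hP : 0 < P) :
    C * (∏ i ∈ s, t i ^ d i) / P ≤ C * (L : ℝ) ^ (1 / 2 : ℝ) * zmin ^ (1 / 2 : ℝ) / P := by
  have h1 := speer_half_bound s t d ht0 ht1 hd
  rw [htel] at h1
  have h3 : ∏ i ∈ s, t i ^ d i ≤ (L : ℝ) ^ (1 / 2 : ℝ) * zmin ^ (1 / 2 : ℝ) :=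
    le_trans h1 (sqrt_ratio_le hL z hsum zmax zmin hmax hmin)
  calc C * (∏ i ∈ s, t i ^ d i) / P ≤ C * ((L : ℝ) ^ (1 / 2 : ℝ) * zmin ^ (1 / 2 : ℝ)) / P :=
        div_le_div_of_nonneg_right (mul_le_mul_of_nonneg_left h3 hC) hP.le
    _ = C * (L : ℝ) ^ (1 / 2 : ℝ) * zmin ^ (1 / 2 : ℝ) / P := by rw [mul_assoc]

end Literature.MathematicalPhysics.QuantumFieldTheory.Volkov2020
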